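import Mathlib
import HarnessLib
import Summits.AtomisticToContinuum.FouriersLaw.Theses.JunctionLocality
import Summits.AtomisticToContinuum.FouriersLaw.Theorems.JunctionLocalityConductanceLowerBoundContactCertificatePairing
import Summits.AtomisticToContinuum.FouriersLaw.Theorems.JunctionLocalityConductanceLowerBoundContactCertificateAlgebraAux1

/-!
# Contact formation, V: Dirichlet identity and transmission form of the adjacent-contact device

Helper file (`--supports` stmt-AtomisticToContinuum-11749) for stub `stub_contactFormation` (R4) of the line
`cold-bath-relocation-walk` of the crux `JunctionLocality.ConductanceLowerBound` (lead c2 worker). For the pinned chain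
(`ω₂ > 0`, `lam, β ≥ 0`, `γ > 0`), `T > 0`, `L ≥ 2` and every classical `C² ∩ L²(μ_T)` solution `g` of the RELOCATED forward
problem with the cold bath on site `1`, `X_H g + γ(S_0 + S_1) g = −(p_0² − T)`:

* finite entropy production at both contacts, `∂_{p_0} g, ∂_{p_1} g ∈ L²(μ_T)` (`Kubo.memLp_partialP`, weights `𝟙_0 + 𝟙_1`);
* the DIRICHLET identity `s := ⟨g, p_0² − T⟩ = γT(‖∂_{p_0}g‖² + ‖∂_{p_1}g‖²)` (`contact_dirichlet`);
* the Gaussian projection `s = T⟨∂_{p_0}g, p_0⟩` (`integral_mul_sq_sub_gibbsMeasure`);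
* the TRANSMISSION FORM of the Kubo conductance: `γ(1 − γs/T²) = (γ³/T)(‖p_0/γ − ∂_{p_0}g‖² + ‖∂_{p_1}g‖²)`
  (`contact_transmission`, registered) — the `m = 1` case of the line's `relocDirichlet`/`relocTransmissionForm`.

References: Eckmann–Pillet–Rey-Bellet 1999 §3; Rey-Bellet 2003 Rem. 4.4; folklore.
-/

noncomputable section

open MeasureTheory Filter Topology
open scoped ContDiff
open Literature.MathematicalPhysics.KineticTheory.HeatConduction
open Summit.AtomisticToContinuum.FouriersLaw.Theorems.SuperadditiveResistance.DeviceLiouville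
  (kin thermo kin_eq_sq continuous_kin liouvilleOp bathOp)
open Summit.AtomisticToContinuum.FouriersLaw.Theorems.SuperadditiveResistance.Kubo (memLp_partialP)
open Summit.AtomisticToContinuum.FouriersLaw.Cruxes.SuperadditiveResistance.FloatingProbeBypassLaplacian
  (pinnedChain_memLp_two_snd pinnedChain_memLp_two_snd_sq pinnedChain_integral_snd_sq integral_mul_sq_sub_gibbsMeasure)

namespace Summit.AtomisticToContinuum.FouriersLaw.Cruxes.ConductanceLowerBound.ColdBathRelocationWalk

variable {ω₂ lam β γ : ℝ} {L : ℕ}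

/-- `Σ_i ([i=0] + [i=1]) a_i = a_0 + a_1` for `L ≥ 2`. [folklore] -/
theorem contact_sum_twoWeights_mul (hL : 2 ≤ L) (a : Fin L → ℝ) :
    ∑ i : Fin L, ((if i.val = 0 then 1 else 0) + (if i.val = 1 then 1 else 0)) * a i =
      a ⟨0, by omega⟩ + a ⟨1, by omega⟩ := by
  -- adapted from `ForecastSensitivity.sum_bathWeight_mul'`
  simp only [add_mul, Finset.sum_add_distrib, ite_mul, one_mul, zero_mul]
  congr 1
  · rw [Finset.sum_eq_single_of_mem (⟨0, by omega⟩ : Fin L) (Finset.mem_univ _)]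
    · rw [if_pos rfl]
    · exact fun b _ hb => if_neg fun h => hb (Fin.ext (by simpa using h))
  · rw [Finset.sum_eq_single_of_mem (⟨1, by omega⟩ : Fin L) (Finset.mem_univ _)]
    · rw [if_pos rfl]
    · exact fun b _ hb => if_neg fun h => hb (Fin.ext (by simpa using h))

/-- The two contact weights are non-negative, and positive at sites `0` and `1`. [folklore] -/
theorem contact_twoWeights_nonneg (i : Fin L) :
    (0 : ℝ) ≤ (if i.val = 0 then 1 else 0) + (if i.val = 1 then 1 else 0) := by
  split_ifs <;> norm_num

/-- **Registered helper `contact_transmission` (R4 `stub_contactFormation`, line `cold-bath-relocation-walk`): DIRICHLET IDENTITY AND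
TRANSMISSION FORM OF THE ADJACENT-CONTACT DEVICE.**  For every classical `C² ∩ L²(μ_T)` solution `g` of
`X_H g + γ(S_0 + S_1)g = −(p_0² − T)` (`L ≥ 2`): `∂_{p_0}g, ∂_{p_1}g ∈ L²(μ_T)`; `⟨g, p_0² − T⟩ = γT(‖∂_{p_0}g‖² + ‖∂_{p_1}g‖²)`;
`⟨g, p_0² − T⟩ = T⟨∂_{p_0}g, p_0⟩`; and `γ(1 − γ⟨g, p_0² − T⟩/T²) = (γ³/T)(‖p_0/γ − ∂_{p_0}g‖² + ‖∂_{p_1}g‖²)`. [folklore] -/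
theorem contact_transmission : ∀ {ω₂ lam β γ T : ℝ}, 0 < ω₂ → 0 ≤ lam → 0 ≤ β → 0 < γ → 0 < T → ∀ {L : ℕ} (hL : 2 ≤ L) {g : PhaseSpace L → ℝ}, ContDiff ℝ 2 g → MemLp g 2 ((pinnedChain ω₂ lam β γ).gibbsMeasure L T) → (∀ x, liouvilleOp (pinnedChain ω₂ lam β γ) L g x + γ * (thermo L 0 T g x + thermo L 1 T g x) = -(kin L 0 x - T)) → MemLp (partialP (⟨0, by omega⟩ : Fin L) g) 2 ((pinnedChain ω₂ lam β γ).gibbsMeasure L T) ∧ MemLp (partialP (⟨1, by omega⟩ : Fin L) g) 2 ((pinnedChain ω₂ lam β γ).gibbsMeasure L T) ∧ ∫ x, g x * (kin L 0 x - T) ∂((pinnedChain ω₂ lam β γ).gibbsMeasure L T) = γ * T * ((∫ x, partialP (⟨0, by omega⟩ : Fin L) g x ^ 2 ∂((pinnedChain ω₂ lam β γ).gibbsMeasure L T)) + ∫ x, partialP (⟨1, by omega⟩ : Fin L) g x ^ 2 ∂((pinnedChain ω₂ lam β γ).gibbsMeasure L T)) ∧ ∫ x, g x * (kin L 0 x -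 T) ∂((pinnedChain ω₂ lam β γ).gibbsMeasure L T) = T * ∫ x, partialP (⟨0, by omega⟩ : Fin L) g x * x.2 ⟨0, by omega⟩ ∂((pinnedChain ω₂ lam β γ).gibbsMeasure L T) ∧ γ * (1 - γ / T ^ 2 * ∫ x, g x * (kin L 0 x - T) ∂((pinnedChain ω₂ lam β γ).gibbsMeasure L T)) = γ ^ 3 / T * ((∫ x, (γ⁻¹ * x.2 ⟨0, by omega⟩ - partialP (⟨0, by omega⟩ : Fin L) g x) ^ 2 ∂((pinnedChain ω₂ lam β γ).gibbsMeasure L T)) + ∫ x, partialP (⟨1, by omega⟩ : Fin L) g x ^ 2 ∂((pinnedChain ω₂ lam β γ).gibbsMeasure L T)) := by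
  intro ω₂ lam β γ T hω hl hβ hγ hT L hL g hgC hgL2 hpde
  have h0 : 0 < L := by omega
  have h1 : 1 < L := by omega
  set i0 : Fin L := ⟨0, h0⟩ with hi0
  set i1 : Fin L := ⟨1, h1⟩ with hi1
  set P := pinnedChain ω₂ lam β γ with hP
  set μ := P.gibbsMeasure L T with hμ
  set B : Fin L → ℝ := fun i => (if i.val = 0 then 1 else 0) + (if i.val = 1 then 1 else 0) with hB
  haveI : IsProbabilityMeasure μ := pinnedChain_isProbabilityMeasure_gibbsMeasure hω hl hβ γ L hT
  have hgd : Differentiable ℝ g := hgC.differentiable two_ne_zero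
  -- the forward pair in weighted form
  have hBnn : ∀ i, 0 ≤ B i := fun i => contact_twoWeights_nonneg i
  have hB0 : 0 < B i0 := by simp [hB, hi0]
  have hB1 : 0 < B i1 := by simp [hB, hi1]
  have hpg : ∀ x, 1 * liouvilleOp P L g x + γ * bathOp L B T g x = -(kin L 0 x - T) := fun x => by
    rw [one_mul, hB, contact_bathOp_two]; exact hpde x
  -- square integrability of the source and of the contact gradients
  have hk0L2 : MemLp (fun x => kin L 0 x - T) 2 μ :=
    ((pinnedChain_memLp_two_snd_sq hω hl hβ γ L hT i0).sub (memLp_const T)).ae_eq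
      (ae_of_all _ fun x => by simp [kin_eq_sq h0, hi0])
  have hga : MemLp (partialP i0 g) 2 μ := memLp_partialP hω hl hβ γ L hT B hBnn 1 hγ hgC hgL2 hk0L2 hpg hB0
  have hgb : MemLp (partialP i1 g) 2 μ := memLp_partialP hω hl hβ γ L hT B hBnn 1 hγ hgC hgL2 hk0L2 hpg hB1
  have hp0 : MemLp (fun x : PhaseSpace L => x.2 i0) 2 μ := pinnedChain_memLp_two_snd hω hl hβ γ L hT i0
  -- (D) Dirichlet identity
  have hDρ := contact_dirichlet hω hl hβ γ L hT B hBnn 1 hγ hgC hgL2 hk0L2 hpg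
  rw [hB, contact_sum_twoWeights_mul hL] at hDρ
  have hD : ∫ x, g x * (kin L 0 x - T) ∂μ =
      γ * T * ((∫ x, partialP i0 g x ^ 2 ∂μ) + ∫ x, partialP i1 g x ^ 2 ∂μ) := by
    rw [P.integral_gibbsMeasure, P.integral_gibbsMeasure, P.integral_gibbsMeasure, hDρ]
    ring
  -- (P) Gaussian projection
  have hA : ∫ x, g x * (kin L 0 x - T) ∂μ = T * ∫ x, partialP i0 g x * x.2 i0 ∂μ := by
    rw [← integral_mul_sq_sub_gibbsMeasure hω hl hβ γ L hT i0 hgd hgL2 hga]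
    exact integral_congr_ae (ae_of_all _ fun x => by dsimp only; rw [kin_eq_sq h0])
  -- the square `‖p_0/γ − ∂_{p_0} g‖²`
  have iaa : Integrable (fun x => partialP i0 g x ^ 2) μ := hga.integrable_sq
  have ipp : Integrable (fun x : PhaseSpace L => x.2 i0 ^ 2) μ := hp0.integrable_sq
  have iap : Integrable (fun x => partialP i0 g x * x.2 i0) μ := hga.integrable_mul hp0
  have hsq : ∫ x, (γ⁻¹ * x.2 i0 - partialP i0 g x) ^ 2 ∂μ =
      γ⁻¹ ^ 2 * T - 2 * γ⁻¹ * (∫ x, partialP i0 g x * x.2 i0 ∂μ) + ∫ x, partialP i0 g x ^ 2 ∂μ := by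
    have ia : Integrable (fun x : PhaseSpace L => γ⁻¹ ^ 2 * x.2 i0 ^ 2) μ := ipp.const_mul _
    have ib : Integrable (fun x => 2 * γ⁻¹ * (partialP i0 g x * x.2 i0)) μ := iap.const_mul _
    have iab : Integrable (fun x => γ⁻¹ ^ 2 * x.2 i0 ^ 2 - 2 * γ⁻¹ * (partialP i0 g x * x.2 i0)) μ := ia.sub ib
    have e1 : ∫ x, (γ⁻¹ * x.2 i0 - partialP i0 g x) ^ 2 ∂μ =
        ∫ x, (γ⁻¹ ^ 2 * x.2 i0 ^ 2 - 2 * γ⁻¹ * (partialP i0 g x * x.2 i0)) + partialP i0 g x ^ 2 ∂μ :=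
      integral_congr_ae (ae_of_all _ fun x => by ring)
    rw [e1, integral_add iab iaa, integral_sub ia ib, integral_const_mul, integral_const_mul,
      pinnedChain_integral_snd_sq hω hl hβ γ L hT i0]
  refine ⟨hga, hgb, hD, hA, ?_⟩
  rw [hsq]
  have hγ0 : γ ≠ 0 := hγ.ne'
  have hT0 : T ≠ 0 := hT.ne'
  field_simp
  -- both sides are polynomial in the three integrals; use (D) and (P)
  nlinarith [hD, hA]

end Summit.AtomisticToContinuum.FouriersLaw.Cruxes.ConductanceLowerBound.ColdBathRelocationWalk

end
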